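import Summits.ResolutionOfSingularities.ResolutionOfSingularities.Theorems.FrobeniusClosingSteerWords17ALandedLeaves
import Summits.ResolutionOfSingularities.ResolutionOfSingularities.Theorems.FrobeniusClosingSteerSSMonomialization
import Summits.ResolutionOfSingularities.ResolutionOfSingularities.Theorems.FrobeniusClosingSteerWords05HeartCycles
import Summits.ResolutionOfSingularities.ResolutionOfSingularities.Theorems.FrobeniusClosingSteerMonomialStageTrichotomy

/-!
# Crux `Steer` (stmt-ResolutionOfSingularities-16345), line `switching-dichotomy` — WORDS 25A: the TAIL, part 1 — B′ ADOPTION (`steeredRebase_member`, `steeredRebase_member_of_eternal`), the S1/S2 adoption leaves (`ssMonomialization_holds`, `monomialStageTrichotomy_holds`), the ODD-CORE vocabulary (`EternalSteeredRun`, `EternalSteeredRunOdd`, `SteeredTailConcl`, `eternalSteeredRun_of`, `eternalSteeredRun_four_of`, `eternalSteeredRunOdd_of_all`, `eternalSteeredRun_two_four_of_two`, `r2FourRankOneTwo_of_all`) and the SSL glue (`eternalAlternationSSL_of_cycle_names`, `eternalStallPhaseSSL_of_S0_S3`, `eternalAlternationSSL_of_S0_S3`) — every PURE declaration of the skeleton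 tail that consumes no registered stub (HOIST of the registered skeleton r48 380a05c149e3c83c, l.4963–5291 minus the stub consumers)

Holder res-L0-w41-lead-1 g6 on res-L0-w41-plan-1 RULING 47 (E1) / 104b; see `…Words01Core` for the hoist protocol (bodies byte for byte;
`[cite: …]` / `[folklore]` tags on CLOSED `def … : Prop` words are written «(ref. …)» / «(folklore)» — GATE NOTE of `…Words02Stubs`;
cite keys inside `[cite:]` tags normalised to `references.bib` keys where needed, as in `…Words03Phases`).
Nothing here is a statement of the manuscript [claim: Hironaka2017, status: under-review]. OURS (candidates / vocabulary; AI review is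
weaker than expert review).
-/

open Summit.ResolutionOfSingularities.ResolutionOfSingularities.Theses.FrobeniusClosing (IsolatedForcedTermination)
open Literature.AlgebraicGeometry.Resolution (IsAbhyankarPlace FGOver exists_ringKrullDim_eq_and_trdeg_eq
  trdeg_eq_trdeg_of_isFractionRing locAtCentre IsQuadraticTransformAlong SubringDominates IsRsopPart
  LocalUniformization3 RelLocalUniformization CossartPiltant2019General)
open Summit.ResolutionOfSingularities.ResolutionOfSingularities.Theorems.SteerRankThinness
  (HasProperCoarsening concl_of_hasProperCoarsening rankOne_of_not_hasProperCoarsening)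
open Summit.ResolutionOfSingularities.ResolutionOfSingularities.Theorems.PfaffLine

set_option linter.dupNamespace false

namespace Summit.ResolutionOfSingularities.ResolutionOfSingularities.Theorems.SwitchingDichotomy.Words

/-- **B′ member re-base at a core datum** (certificate that p502870 applies to the skeleton's literal `CoreDatum` /
`IsSteeredRunUpTo` / `IsPermissibleCentre` / `Concl` by `obtain`/`exact`). OURS. [folklore] -/
theorem steeredRebase_member (p : ℕ) (hp : p.Prime) (n : ℕ)
    (k K : Type) [Field k] [CharP k p] [PerfectField k] [Field K] [Algebra k K]
    (O : ValuationSubring K) (A₀ : Subalgebra k K) (h₀ : A₀.toSubring ≤ O.toSubring) (t : K)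
    (core : CoreDatum p n k K O A₀ h₀ t)
    (R : ℕ → Subring K) (P : (i : ℕ) → Ideal (R i)) (s : ℕ → K) (N : ℕ)
    (hR0 : R 0 = locAtCentre A₀.toSubring O) (hrun : IsSteeredRunUpTo O R P t p s N) :
    ∃ (A' : Subalgebra k K) (h' : A'.toSubring ≤ O.toSubring), A₀ ≤ A' ∧
      locAtCentre A'.toSubring O = R N ∧ A'.FG ∧ s N ^ p ∈ A' ∧
      t ∈ Algebra.adjoin k (insert (s N) (A' : Set K)) ∧
      IsFractionRing (Algebra.adjoin k (insert (s N) (A' : Set K))) K ∧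
      IsRegularLocalRing (Localization.AtPrime
        (Ideal.comap (Subring.inclusion h') (IsLocalRing.maximalIdeal O))) ∧
      (Concl O A' (s N) → Concl O A₀ t) ∧
      (Concl O A' (s N) ∨ CoreDatum p n k K O A' h' (s N)) := by
  obtain ⟨hfg, htp, hfr, hreg, -, hzd, -, -, -, -, -, -, htr, -⟩ := core
  obtain ⟨hs0, hsle, hst⟩ := hrun
  obtain ⟨A', h', hle, hRN, hfg', hsp', ht', hfr', hreg', hpush⟩ :=
    Summit.ResolutionOfSingularities.ResolutionOfSingularities.Theorems.SwitchingDichotomy.SteeredRebase.steeredRebase_of_run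
      (fun S hS f Q => @IsPermissibleCentre K _ S hS p f Q) p
      (fun S hS f Q hperm => by
        obtain ⟨hQ, -⟩ := hperm.2.1
        exact ⟨hQ.ne_top, hperm.2.2.1⟩)
      O A₀ h₀ t hfg hfr hreg R P s N hR0 hs0 (hsle N le_rfl) hst
  exact ⟨A', h', hle, hRN, hfg', hsp', ht', hfr', hreg', hpush,
    concl_or_coreDatum p hp n k K O A' h' (s N) htr hzd hfg' hsp' hfr' hreg'⟩

/-- **The same along an ETERNAL steered run, at every index `N`** (restriction `IsSteeredRun → IsSteeredRunUpTo N`). -/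
theorem steeredRebase_member_of_eternal (p : ℕ) (hp : p.Prime) (n : ℕ)
    (k K : Type) [Field k] [CharP k p] [PerfectField k] [Field K] [Algebra k K]
    (O : ValuationSubring K) (A₀ : Subalgebra k K) (h₀ : A₀.toSubring ≤ O.toSubring) (t : K)
    (core : CoreDatum p n k K O A₀ h₀ t)
    (R : ℕ → Subring K) (P : (i : ℕ) → Ideal (R i)) (s : ℕ → K)
    (hR0 : R 0 = locAtCentre A₀.toSubring O) (hrun : IsSteeredRun O R P t p s) (N : ℕ) :
    ∃ (A' : Subalgebra k K) (h' : A'.toSubring ≤ O.toSubring), A₀ ≤ A' ∧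
      locAtCentre A'.toSubring O = R N ∧ A'.FG ∧ s N ^ p ∈ A' ∧
      t ∈ Algebra.adjoin k (insert (s N) (A' : Set K)) ∧
      IsFractionRing (Algebra.adjoin k (insert (s N) (A' : Set K))) K ∧
      IsRegularLocalRing (Localization.AtPrime
        (Ideal.comap (Subring.inclusion h') (IsLocalRing.maximalIdeal O))) ∧
      (Concl O A' (s N) → Concl O A₀ t) ∧
      (Concl O A' (s N) ∨ CoreDatum p n k K O A' h' (s N)) := by
  obtain ⟨hs0, hst⟩ := hrun
  refine steeredRebase_member p hp n k K O A₀ h₀ t core R P s N hR0 ⟨hs0, fun i _ => ?_, fun i _ => hst i⟩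
  obtain ⟨_, hs, -⟩ := hst i
  exact hs

/-! ### (a) adoption leaves for S1 (res-D-pv-010 p504463) and S2 (res-type-028 p505120, leaf text from its 06:28:24Z line) -/

/-- **S1 holds** (res-D-pv-010 AS res-L0-w41-stub-6, p504463 `SSMonomialization.ssMonomialization` = the S1 body with the vocabulary
unfolded; by `defeq`). -/
theorem ssMonomialization_holds : SSMonomialization :=
  fun p hp hp2 n hn k K _ _ _ _ _ O A₀ h₀ t core hss hrank R hR0 hRq M h hh hh0 =>
    Summit.ResolutionOfSingularities.ResolutionOfSingularities.Theorems.SwitchingDichotomy.SSMonomialization.ssMonomialization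
      p hp hp2 n hn k K O A₀ h₀ t core hss hrank R hR0 hRq M h hh hh0

/-- **S2 holds** (res-type-028, p505120 `MonomialStage.monomialStage_trichotomy`; adoption leaf verbatim from the author's line). -/
theorem monomialStageTrichotomy_holds : MonomialStageTrichotomy := by
  intro p hp hp2 n hn k K _ _ _ _ _ O A₀ h₀ t core hss hrank R hR0 hRq M s hgen hmono
  obtain ⟨hfg, htp, hK0, hreg, hmax, h0, hdim, hnA, hnDA, hnDisc, hδ, hc, htr, hreg3⟩ := core
  exact Summit.ResolutionOfSingularities.ResolutionOfSingularities.Theorems.SwitchingDichotomy.MonomialStage.monomialStage_trichotomy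
    p hp O A₀ h₀ t htp hreg h0 hc R hR0 hRq M s hgen hmono

/-! ### §U.1 T for all characteristics and dimensions, and its line (p-generic twins of r20's `EternalSteeredRunTwo` /
`SteeredTailConclTwo` / `eternalSteeredRunTwo_of`; binders `TorsorLUZeroDimBelow p n` and `(n = 4 → ¬ HasProperCoarsening O)` added) -/

/-- **T · EternalSteeredRun** (FRONTIER; p- and n-generic umbrella of r20's registered `EternalSteeredRunTwo`): an ETERNAL
σ_top-steered run from a core datum of transcendence degree `n ≥ 4` (rank one when `n = 4`; torsor LU below `n` in hand) still
yields `Concl`. LINE: `eternalSteeredRun_of` (σ-residual `SteeredTailConcl` + G `GeoDict` + K(1) + K(2) + K(≥ 3)). Why it might fail: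
σ_top may alternate point and positive-dimensional steps for ever with no dominant tail (no termination invariant for
positive-dimensional centres in characteristic `p` is on record). `Literature.Barriers.ResolutionOfSingularities.DimensionFourFrontier`.
(ref. HeinzerEtAl2015, Discussion 4.2) (ref. CutkoskyMourtada2019, Thm. 7.1) OURS. -/
def EternalSteeredRun : Prop :=
  ∀ p : ℕ, p.Prime → ∀ n : ℕ, 4 ≤ n → TorsorLUZeroDimBelow p n →
    ∀ (k K : Type) [Field k] [CharP k p] [PerfectField k] [Field K] [Algebra k K]
    (O : ValuationSubring K) (A₀ : Subalgebra k K) (h₀ : A₀.toSubring ≤ O.toSubring) (t : K),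
    CoreDatum p n k K O A₀ h₀ t → (n = 4 → ¬ HasProperCoarsening O) →
    ∀ (R : ℕ → Subring K) (P : (i : ℕ) → Ideal (R i)) (s : ℕ → K),
      R 0 = locAtCentre A₀.toSubring O → IsSteeredRun O R P t p s → Concl O A₀ t

/-- **T_odd · EternalSteeredRunOdd** (FRONTIER; the odd-characteristic part of `EternalSteeredRun`, the eternal-run input of the
unified machine). (ref. HeinzerEtAl2015, Discussion 4.2) OURS. -/
def EternalSteeredRunOdd : Prop :=
  ∀ p : ℕ, p.Prime → p ≠ 2 → ∀ n : ℕ, 4 ≤ n → TorsorLUZeroDimBelow p n →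
    ∀ (k K : Type) [Field k] [CharP k p] [PerfectField k] [Field K] [Algebra k K]
    (O : ValuationSubring K) (A₀ : Subalgebra k K) (h₀ : A₀.toSubring ≤ O.toSubring) (t : K),
    CoreDatum p n k K O A₀ h₀ t → (n = 4 → ¬ HasProperCoarsening O) →
    ∀ (R : ℕ → Subring K) (P : (i : ℕ) → Ideal (R i)) (s : ℕ → K),
      R 0 = locAtCentre A₀.toSubring O → IsSteeredRun O R P t p s → Concl O A₀ t

/-- **σ-RESIDUAL, all `p`, all `n ≥ 4`** (FRONTIER; umbrella of r20's `SteeredTailConclTwo`; its p = 2, n = 4 part is cut by run shape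
PT₁/ALT₁/WANDER₁ in `L/w41/R2TwoSigma-r19.snippet.lean` v7 §σ2.10): an eternal σ_top-steered run with NO dominant tail of any
codimension still yields `Concl`. (ref. HeinzerEtAl2015, Discussion 4.2) OURS. -/
def SteeredTailConcl : Prop :=
  ∀ p : ℕ, p.Prime → ∀ n : ℕ, 4 ≤ n → TorsorLUZeroDimBelow p n →
    ∀ (k K : Type) [Field k] [CharP k p] [PerfectField k] [Field K] [Algebra k K]
    (O : ValuationSubring K) (A₀ : Subalgebra k K) (h₀ : A₀.toSubring ≤ O.toSubring) (t : K),
    CoreDatum p n k K O A₀ h₀ t → (n = 4 → ¬ HasProperCoarsening O) →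
    ∀ (R : ℕ → Subring K) (P : (i : ℕ) → Ideal (R i)) (s : ℕ → K),
      R 0 = locAtCentre A₀.toSubring O → IsSteeredRun O R P t p s →
      (¬ ∃ i₀ c : ℕ, 1 ≤ c ∧ IsDominantTail R P i₀ c) → Concl O A₀ t

/-- **T from its line, all `p` and `n`**: σ-residual + G `GeoDict` (∀ n, res-D-pv-011 p501788/p502487 + assembly) + K(1) (p500126) +
K(2) (Lipman port, res-type-026 + o8) + K(≥ 3) `NoEternalIsolatedRadicandChainHigh` (FRONTIER, idea-1). No codimension cap is needed
once K(≥ 3) is the all-codimension name (r20's `TailCodimBound` p502821 only matters to cut K at `c ≤ 3` when `n = 4`). Pure logic.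
OURS. [folklore] -/
theorem eternalSteeredRun_of (hTail : SteeredTailConcl) (hG : GeoDict)
    (hK1 : ∀ p : ℕ, p.Prime → NoEternalIsolatedRadicandChain p 1)
    (hK2 : ∀ p : ℕ, p.Prime → NoEternalIsolatedRadicandChain p 2)
    (hKH : NoEternalIsolatedRadicandChainHigh) : EternalSteeredRun := by
  intro p hp n hn hBelow k K _ _ _ _ _ O A₀ h₀ t core hnc R P s hR0 hrun
  by_cases htail : ∃ i₀ c : ℕ, 1 ≤ c ∧ IsDominantTail R P i₀ c
  · obtain ⟨i₀, c, hc1, ht⟩ := htail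
    have hncc : ¬ NoEternalIsolatedRadicandChain p c :=
      hG p hp n hn k K O A₀ h₀ t core R P s i₀ c hR0 hrun ht
    rcases Nat.lt_or_ge c 3 with hc3 | hc3
    · interval_cases c
      · exact (hncc (hK1 p hp)).elim
      · exact (hncc (hK2 p hp)).elim
    · exact (hncc (hKH p hp c hc3)).elim
  · exact hTail p hp n hn hBelow k K O A₀ h₀ t core hnc R P s hR0 hrun htail

/-- **T at `n = 4` from its line with K cut at codimension `3`** (r20's `eternalSteeredRunTwo_of` shape, all `p`): σ-residual + G +
`TailCodimBound` + K(1) + K(2) + K(3). Stated as the `n = 4` instance of `EternalSteeredRun`. Pure logic. OURS. [folklore] -/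
theorem eternalSteeredRun_four_of (hTail : SteeredTailConcl) (hG : GeoDict) (hcb : TailCodimBound)
    (hK1 : ∀ p : ℕ, p.Prime → NoEternalIsolatedRadicandChain p 1)
    (hK2 : ∀ p : ℕ, p.Prime → NoEternalIsolatedRadicandChain p 2)
    (hK3 : ∀ p : ℕ, p.Prime → NoEternalIsolatedRadicandChain p 3) :
    ∀ p : ℕ, p.Prime → TorsorLUZeroDimBelow p 4 →
    ∀ (k K : Type) [Field k] [CharP k p] [PerfectField k] [Field K] [Algebra k K]
    (O : ValuationSubring K) (A₀ : Subalgebra k K) (h₀ : A₀.toSubring ≤ O.toSubring) (t : K),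
    CoreDatum p 4 k K O A₀ h₀ t → ¬ HasProperCoarsening O →
    ∀ (R : ℕ → Subring K) (P : (i : ℕ) → Ideal (R i)) (s : ℕ → K),
      R 0 = locAtCentre A₀.toSubring O → IsSteeredRun O R P t p s → Concl O A₀ t := by
  intro p hp hBelow k K _ _ _ _ _ O A₀ h₀ t core hrank R P s hR0 hrun
  by_cases htail : ∃ i₀ c : ℕ, 1 ≤ c ∧ IsDominantTail R P i₀ c
  · obtain ⟨i₀, c, hc1, ht⟩ := htail
    have hncc : ¬ NoEternalIsolatedRadicandChain p c :=
      hG p hp 4 le_rfl k K O A₀ h₀ t core R P s i₀ c hR0 hrun ht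
    have hc4 : c + 1 ≤ 4 := hcb p hp 4 le_rfl k K O A₀ h₀ t core R P s i₀ c hR0 hrun ht
    have hc3 : c ≤ 3 := by omega
    interval_cases c
    · exact (hncc (hK1 p hp)).elim
    · exact (hncc (hK2 p hp)).elim
    · exact (hncc (hK3 p hp)).elim
  · exact hTail p hp 4 le_rfl hBelow k K O A₀ h₀ t core (fun _ => hrank) R P s hR0 hrun htail

/-- The odd part of the umbrella. Pure logic. [folklore] -/
theorem eternalSteeredRunOdd_of_all (h : EternalSteeredRun) : EternalSteeredRunOdd :=
  fun p hp _ n hn hBelow k K _ _ _ _ _ O A₀ h₀ t core hnc R P s hR0 hrun =>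
    h p hp n hn hBelow k K O A₀ h₀ t core hnc R P s hR0 hrun

/-- r20's registered `EternalSteeredRunTwo` (no `Below` binder) gives the p = 2, n = 4 instance of the umbrella, so every landed
σ-piece at p = 2 (PT₁/ALT₁/WANDER₁ lines) still lands in the umbrella slot. Pure logic. [folklore] -/
theorem eternalSteeredRun_two_four_of_two (hT : EternalSteeredRunTwo) :
    ∀ p : ℕ, p = 2 → TorsorLUZeroDimBelow p 4 →
    ∀ (k K : Type) [Field k] [CharP k p] [PerfectField k] [Field K] [Algebra k K]
    (O : ValuationSubring K) (A₀ : Subalgebra k K) (h₀ : A₀.toSubring ≤ O.toSubring) (t : K),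
    CoreDatum p 4 k K O A₀ h₀ t → ¬ HasProperCoarsening O →
    ∀ (R : ℕ → Subring K) (P : (i : ℕ) → Ideal (R i)) (s : ℕ → K),
      R 0 = locAtCentre A₀.toSubring O → IsSteeredRun O R P t p s → Concl O A₀ t :=
  fun p hp2 _ k K _ _ _ _ _ O A₀ h₀ t core hrank R P s hR0 hrun => hT p hp2 k K O A₀ h₀ t core hrank R P s hR0 hrun


/-! ### (b′) the p = 2, n = 4 composition over the umbrella (r22's `r2FourRankOneTwo_of` shape, `Below` passed) -/

/-- **`R2FourRankOneTwo` from the σ_top line at p = 2 over the UMBRELLA T** (r20's `r2FourRankOneTwo_of` with `EternalSteeredRun` in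
place of `EternalSteeredRunTwo`; the `Below` binder is passed). Pure logic. [folklore] -/
theorem r2FourRankOneTwo_of_all (hX : SteeredExit) (hE : SteeredRunExists) (hB : EmptyStallTwo)
    (hT : EternalSteeredRun) : R2FourRankOneTwo := by
  intro p hp2 hBelow k K _i1 _i2 _i3 _i4 _i5 O A₀ h₀ t hfg htp hK0 hreg hmax h0 hdim hnA hnDA hnDisc hδ hc htr hrank
    hreg3 _R _hR0 _hRq _s _hrun _hni
  have hp : p.Prime := hp2 ▸ Nat.prime_two
  have core : CoreDatum p 4 k K O A₀ h₀ t :=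
    ⟨hfg, htp, hK0, hreg, hmax, h0, hdim, hnA, hnDA, hnDisc, hδ, hc, htr, hreg3⟩
  rcases hE p hp 4 le_rfl k K O A₀ h₀ t core with
    ⟨R, P, s, N, hR0, hrun, hexit | hstall⟩ | ⟨R, P, s, hR0, hrun⟩
  · exact hX p hp 4 le_rfl k K O A₀ h₀ t core R P s N hR0 hrun hexit
  · exact (hB p hp2 4 le_rfl k K O A₀ h₀ t core R P s N hR0 hrun hstall).elim
  · exact hT p hp 4 le_rfl hBelow k K O A₀ h₀ t core (fun _ => hrank) R P s hR0 hrun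

/-- **Φ3ᴸˢ and Φ4ᴸˢ need not survive either** (r22 already has `…_of_cycles`; recorded so the r23 stub list can be read off this file):
the six r22 stubs shrink to {`stub_cp2019General`, `stub_nonSwitchingCore`, S0, S2 (dischargeable), S3, umbrella T}. -/
theorem eternalAlternationSSL_of_cycle_names (hS0 : CompositeRankSS) (hS1 : SSMonomialization)
    (hS2 : MonomialStageTrichotomy) (hS3 : EternalCyclesSS) : EternalAlternationSSL :=
  eternalAlternationSSL_of_cycles hS0 hS1 hS2 hS3

/-- **Φ3ᴸˢ from S0 + S3** (r22's `eternalStallPhaseSSL_of_cycles` with S1, S2 plugged). [folklore] -/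
theorem eternalStallPhaseSSL_of_S0_S3 (hS0 : CompositeRankSS) (hS3 : EternalCyclesSS) : EternalStallPhaseSSL :=
  eternalStallPhaseSSL_of_cycles hS0 ssMonomialization_holds monomialStageTrichotomy_holds hS3

/-- **Φ4ᴸˢ from S0 + S3** (r22's `eternalAlternationSSL_of_cycles` with S1, S2 plugged). [folklore] -/
theorem eternalAlternationSSL_of_S0_S3 (hS0 : CompositeRankSS) (hS3 : EternalCyclesSS) : EternalAlternationSSL :=
  eternalAlternationSSL_of_cycles hS0 ssMonomialization_holds monomialStageTrichotomy_holds hS3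

end Summit.ResolutionOfSingularities.ResolutionOfSingularities.Theorems.SwitchingDichotomy.Words
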